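import Summits.CriticalPhenomena.PercolationContinuityZ3.Theorems.PercNearOneGluingNoHeavyLowerTailRefinedRowR2FourFunctions
import HarnessLib

/-!
# `NoHeavyLowerTail` (stmt-CriticalPhenomena-4575) — the separation atoms ARE the refined cells (dictionary for `SepDual`)

Support file (prover prim-gen-kcluster gen 50; `--supports stmt-CriticalPhenomena-4575`).  No named facts, no sorries, no definitions.

`…RefinedRowsSepDualRandomCluster` (this gen) derives R3 and R4⁺ from R1 for every `φ_{𝐩,q}`, `q ≥ 1`, on the atoms of the three
separation events `Sep_a = Sep D (cl X a) b c`, `Sep_b = Sep D (cl X b) a c`, `Sep_c = Sep D (cl X c) a b`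
(`RefinedRowR3.Sep`: the cluster meets every support path between the two other terminals; by convention true when it contains one of
them).  This file proves, for configurations `X ⊆ D` on a support joining the (distinct) terminals, that these eight atoms are
literally the refined cells of `…RefinedRowR3Switching` / `…RefinedRowR2FourFunctions`:

| atom `(Sep_a, Sep_b, Sep_c)` | cell | lemma |
|---|---|---|
| `(1,1,1)` | `T` (`cellT`) | `mem_cellT_iff_sep` |
| `(1,0,0)`, `(0,1,0)`, `(0,0,1)` | `S_a`, `S_b`, `S_c` (`cellSa`, `cellSb`, `cellSc`) | `mem_cellSa_iff_sep`, `mem_cellSb_iff_sep`, `mem_cellSc_iff_sep` |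
| `(0,1,1)`, `(1,0,1)`, `(1,1,0)` | `U_a`, `U_b`, `U_c` (`cellUa`, `cellUc a c b`, `cellUc`) | `mem_cellUa_iff_sep`, `mem_cellUb_iff_sep`, `mem_cellUc_iff_sep` |
| `(0,0,0)` | `B_0` (`cellB0`) | `mem_cellB0_iff_sep` |

— the S-side image of the pivotal three-event dictionary of `…PivotalThreeEvents` / `…PivotalCellsRandomCluster` (`T₀ ↔ B_0`,
`T_x ↔ S_x`, `u_x ↔ u_x`, `q ↔ t` under `H_x ↔ ¬Sep_x`).  Tools: `sep_of_mem_cl_left/right` (a cluster containing a terminal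
separates it from everything), `not_sep_of_mem_cl` (an open path avoiding the cluster defeats separation; needs `X ⊆ D`) and
`RefinedRowR3.not_sep_sep` (two clusters cannot both separate).  Hence the hypotheses of `SepDual.r3_of_r1_rcMeasureW` /
`r4plus_of_r1_rcMeasureW` are R1 in the cells `t·s_a ≤ u_b·u_c` and their conclusions are R3 `s_a s_b ≤ u_c b₀` and
R4⁺ `s_a(u_a+s_c) ≤ u_b(b₀+s_b)` for supports carrying the parameters.
-/

namespace Summit.CriticalPhenomena.PercolationContinuityZ3.Theorems

namespace SepDual

open Finset Literature.Probability.Percolation Literature.Probability.Percolation.DecisionTree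
open Literature.Probability.Percolation.Gladkov ThreePointLB RefinedRowR3 RefinedRowR2
open scoped Classical

variable {V : Type*} [Fintype V] [DecidableEq V]

/-! ### Three tools -/

/-- A cluster containing `y` separates `y` from every other vertex (every support edge at `y` touches it). [this work] -/
theorem sep_of_mem_cl_left {D X : Finset (Sym2 V)} {x y z : V} (hy : y ∈ cl X x) (hyz : y ≠ z) :
    Sep D (cl X x) y z := by
  intro hz
  obtain ⟨w⟩ := mem_cl.1 hz
  cases w with
  | nil => exact hyz rfl
  | cons hadj _ =>
    rw [adj_iff] at hadj
    exact (Finset.mem_sdiff.1 hadj.1).2 (mk_mem_touch.2 (Or.inl hy))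

/-- A cluster containing `z` separates every other vertex from `z`. [this work] -/
theorem sep_of_mem_cl_right {D X : Finset (Sym2 V)} {x y z : V} (hz : z ∈ cl X x) (hyz : y ≠ z) :
    Sep D (cl X x) y z :=
  sep_comm.2 (sep_of_mem_cl_left hz hyz.symm)

/-- An open `y–z` path of a configuration inside the support, in a cluster other than that of `x`, defeats separation by
the cluster of `x`. [this work] -/
theorem not_sep_of_mem_cl {D X : Finset (Sym2 V)} {x y z : V} (hXD : X ⊆ D) (hyz : z ∈ cl X y) (hxy : y ∉ cl X x) :
    ¬ Sep D (cl X x) y z := fun h =>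
  h (cl_subset_cl_sdiff_touch hXD (fun _ hv => not_mem_cl_of_mem_cl hv fun hx => hxy (mem_cl_comm.1 hx)) hyz)

/-! ### The eight atoms -/

section Atoms

variable {D X : Finset (Sym2 V)} {a b c : V}

/-- `T`: `X ∈ cellT a b c ↔ Sep_a ∧ Sep_b ∧ Sep_c`. [this work] -/
theorem mem_cellT_iff_sep (hXD : X ⊆ D) (hab : a ≠ b) (hac : a ≠ c) (hbc : b ≠ c) (hDc : c ∈ cl D a) :
    X ∈ cellT a b c ↔ Sep D (cl X a) b c ∧ Sep D (cl X b) a c ∧ Sep D (cl X c) a b := by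
  rw [mem_cellT]
  constructor
  · rintro ⟨hb, hc⟩
    exact ⟨sep_of_mem_cl_left hb hbc, sep_of_mem_cl_left (mem_cl_comm.1 hb) hac,
      sep_of_mem_cl_left (mem_cl_comm.1 hc) hab⟩
  · rintro ⟨hSa, hSb, hSc⟩
    by_cases hb : b ∈ cl X a <;> by_cases hc : c ∈ cl X a
    · exact ⟨hb, hc⟩
    · exact absurd hSc (not_sep_of_mem_cl hXD hb fun h => hc (mem_cl_comm.1 h))
    · exact absurd hSb (not_sep_of_mem_cl hXD hc fun h => hb (mem_cl_comm.1 h))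
    · by_cases hcb : c ∈ cl X b
      · exact absurd hSa (not_sep_of_mem_cl hXD hcb hb)
      · exact (not_sep_sep hXD hb hDc hSa hSb).elim

/-- `S_a`: `X ∈ cellSa D a b c ↔ Sep_a ∧ ¬Sep_b ∧ ¬Sep_c`. [this work] -/
theorem mem_cellSa_iff_sep (hXD : X ⊆ D) (hab : a ≠ b) (hac : a ≠ c) (hDb : b ∈ cl D a) (hDc : c ∈ cl D a) :
    X ∈ cellSa D a b c ↔ Sep D (cl X a) b c ∧ ¬ Sep D (cl X b) a c ∧ ¬ Sep D (cl X c) a b := by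
  rw [mem_cellSa, mem_apart]
  constructor
  · rintro ⟨⟨hb, hc, _⟩, hsep⟩
    refine ⟨hsep, fun hSb => not_sep_sep hXD hb hDc hsep hSb, fun hSc => ?_⟩
    exact not_sep_sep (x := a) (y := c) (z := b) hXD hc hDb (sep_comm.1 hsep) hSc
  · rintro ⟨hSa, hnSb, hnSc⟩
    refine ⟨⟨fun hb => hnSb (sep_of_mem_cl_left (mem_cl_comm.1 hb) hac),
      fun hc => hnSc (sep_of_mem_cl_left (mem_cl_comm.1 hc) hab),
      fun hcb => hnSc (sep_of_mem_cl_right (mem_cl_comm.1 hcb) hab)⟩, hSa⟩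

/-- `S_b`: `X ∈ cellSb D a b c ↔ ¬Sep_a ∧ Sep_b ∧ ¬Sep_c`. [this work] -/
theorem mem_cellSb_iff_sep (hXD : X ⊆ D) (hab : a ≠ b) (hbc : b ≠ c) (hDb : b ∈ cl D a) (hDc : c ∈ cl D a) :
    X ∈ cellSb D a b c ↔ ¬ Sep D (cl X a) b c ∧ Sep D (cl X b) a c ∧ ¬ Sep D (cl X c) a b := by
  rw [mem_cellSb, mem_apart]
  have hDa' : a ∈ cl D b := mem_cl_comm.1 hDb
  constructor
  · rintro ⟨⟨hb, _, hcb⟩, hsep⟩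
    refine ⟨fun hSa => not_sep_sep hXD hb hDc hSa hsep, hsep, fun hSc => ?_⟩
    exact not_sep_sep (x := b) (y := c) (z := a) hXD hcb hDa' (sep_comm.1 hsep) (sep_comm.1 hSc)
  · rintro ⟨hnSa, hSb, hnSc⟩
    refine ⟨⟨fun hb => hnSa (sep_of_mem_cl_left hb hbc), fun hc => hnSa (sep_of_mem_cl_right hc hbc),
      fun hcb => hnSc (sep_of_mem_cl_right (mem_cl_comm.1 hcb) hab)⟩, hSb⟩

/-- `S_c`: `X ∈ cellSc D a b c ↔ ¬Sep_a ∧ ¬Sep_b ∧ Sep_c`. [this work] -/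
theorem mem_cellSc_iff_sep (hXD : X ⊆ D) (hac : a ≠ c) (hbc : b ≠ c) (hDb : b ∈ cl D a) :
    X ∈ cellSc D a b c ↔ ¬ Sep D (cl X a) b c ∧ ¬ Sep D (cl X b) a c ∧ Sep D (cl X c) a b := by
  rw [mem_cellSc, mem_apart]
  have hDa' : a ∈ cl D b := mem_cl_comm.1 hDb
  constructor
  · rintro ⟨⟨_, hc, hcb⟩, hsep⟩
    refine ⟨fun hSa => ?_, fun hSb => ?_, hsep⟩
    · exact not_sep_sep (x := a) (y := c) (z := b) hXD hc hDb (sep_comm.1 hSa) hsep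
    · exact not_sep_sep (x := b) (y := c) (z := a) hXD hcb hDa' (sep_comm.1 hSb) (sep_comm.1 hsep)
  · rintro ⟨hnSa, hnSb, hSc⟩
    exact ⟨⟨fun hb => hnSa (sep_of_mem_cl_left hb hbc), fun hc => hnSa (sep_of_mem_cl_right hc hbc),
      fun hcb => hnSb (sep_of_mem_cl_right hcb hac)⟩, hSc⟩

/-- `B_0`: `X ∈ cellB0 D a b c ↔ ¬Sep_a ∧ ¬Sep_b ∧ ¬Sep_c`. [this work] -/
theorem mem_cellB0_iff_sep (hac : a ≠ c) (hbc : b ≠ c) :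
    X ∈ cellB0 D a b c ↔ ¬ Sep D (cl X a) b c ∧ ¬ Sep D (cl X b) a c ∧ ¬ Sep D (cl X c) a b := by
  rw [mem_cellB0, mem_apart]
  constructor
  · rintro ⟨_, h1, h2, h3⟩
    exact ⟨h1, h2, h3⟩
  · rintro ⟨hnSa, hnSb, hnSc⟩
    exact ⟨⟨fun hb => hnSa (sep_of_mem_cl_left hb hbc), fun hc => hnSa (sep_of_mem_cl_right hc hbc),
      fun hcb => hnSb (sep_of_mem_cl_right hcb hac)⟩, hnSa, hnSb, hnSc⟩

/-- `U_c` (`ab|c`): `X ∈ cellUc a b c ↔ Sep_a ∧ Sep_b ∧ ¬Sep_c`. [this work] -/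
theorem mem_cellUc_iff_sep (hXD : X ⊆ D) (hab : a ≠ b) (hac : a ≠ c) (hbc : b ≠ c) (hDc : c ∈ cl D a) :
    X ∈ cellUc a b c ↔ Sep D (cl X a) b c ∧ Sep D (cl X b) a c ∧ ¬ Sep D (cl X c) a b := by
  rw [mem_cellUc]
  constructor
  · rintro ⟨hb, hnc⟩
    exact ⟨sep_of_mem_cl_left hb hbc, sep_of_mem_cl_left (mem_cl_comm.1 hb) hac,
      not_sep_of_mem_cl hXD hb fun h => hnc (mem_cl_comm.1 h)⟩
  · rintro ⟨hSa, hSb, hnSc⟩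
    have hnc : c ∉ cl X a := fun hc => hnSc (sep_of_mem_cl_left (mem_cl_comm.1 hc) hab)
    refine ⟨?_, hnc⟩
    by_contra hb
    by_cases hcb : c ∈ cl X b
    · exact not_sep_of_mem_cl hXD hcb hb hSa
    · exact not_sep_sep hXD hb hDc hSa hSb

/-- `U_b` (`ac|b`): `X ∈ cellUc a c b ↔ Sep_a ∧ ¬Sep_b ∧ Sep_c`. [this work] -/
theorem mem_cellUb_iff_sep (hXD : X ⊆ D) (hab : a ≠ b) (hac : a ≠ c) (hbc : b ≠ c) (hDb : b ∈ cl D a) :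
    X ∈ cellUc a c b ↔ Sep D (cl X a) b c ∧ ¬ Sep D (cl X b) a c ∧ Sep D (cl X c) a b := by
  rw [mem_cellUc]
  constructor
  · rintro ⟨hc, hnb⟩
    exact ⟨sep_of_mem_cl_right hc hbc, not_sep_of_mem_cl hXD hc fun h => hnb (mem_cl_comm.1 h),
      sep_of_mem_cl_left (mem_cl_comm.1 hc) hab⟩
  · rintro ⟨hSa, hnSb, hSc⟩
    have hnb : b ∉ cl X a := fun hb => hnSb (sep_of_mem_cl_left (mem_cl_comm.1 hb) hac)
    refine ⟨?_, hnb⟩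
    by_contra hc
    by_cases hbc' : b ∈ cl X c
    · exact not_sep_of_mem_cl hXD hbc' hc (sep_comm.1 hSa)
    · exact not_sep_sep (x := a) (y := c) (z := b) hXD hc hDb (sep_comm.1 hSa) hSc

/-- `U_a` (`a|bc`): `X ∈ cellUa a b c ↔ ¬Sep_a ∧ Sep_b ∧ Sep_c`. [this work] -/
theorem mem_cellUa_iff_sep (hXD : X ⊆ D) (hab : a ≠ b) (hac : a ≠ c) (hbc : b ≠ c) (hDb : b ∈ cl D a) :
    X ∈ cellUa a b c ↔ ¬ Sep D (cl X a) b c ∧ Sep D (cl X b) a c ∧ Sep D (cl X c) a b := by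
  rw [mem_cellUa]
  have hDa' : a ∈ cl D b := mem_cl_comm.1 hDb
  constructor
  · rintro ⟨hb, _, hcb⟩
    exact ⟨not_sep_of_mem_cl hXD hcb hb, sep_of_mem_cl_right hcb hac,
      sep_of_mem_cl_right (mem_cl_comm.1 hcb) hab⟩
  · rintro ⟨hnSa, hSb, hSc⟩
    have hb : b ∉ cl X a := fun hb => hnSa (sep_of_mem_cl_left hb hbc)
    have hc : c ∉ cl X a := fun hc => hnSa (sep_of_mem_cl_right hc hbc)
    refine ⟨hb, hc, ?_⟩
    by_contra hcb
    exact not_sep_sep (x := b) (y := c) (z := a) hXD hcb hDa' (sep_comm.1 hSb) (sep_comm.1 hSc)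

end Atoms

end SepDual

end Summit.CriticalPhenomena.PercolationContinuityZ3.Theorems
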